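/-
Copyright (c) 2026 the pub-hodgecm-mathlib formalisation cell (harness21).  Prover seat hodgecm-mathlib-A-p06 (g29) — (U) road, U4-DISCHARGE (W2)-(n2), FILE 6 «the top-form disc constant: junction
spelling, real form, value π²∕2» (owner A-p19 (g24) MEMO-U4-NC-v1 §1 (n2); LEAD F0P3a-plan (g10) T9-40∕T9-41).
-/
import Literature.NumberTheory.Weil1964.UnitaryArchTopFormDiscConstant          -- FILE 5 (A-p06 g29): `topFormDiscConstant_mul_pi_eq_lintegral`, `exists_topFormDiscConstant`
import Literature.NumberTheory.Weil1964.UnitaryArchLocalCayleyWeightMassTwo      -- ★ p844882 (A-p12 g20) (b3)-(iii): `lintegral_cayleyWeightC_two` (`∫_{𝔲(2)} w₀ dλ = π³∕2`)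
import HarnessLib

/-!
# The top-form disc constant of `U(1,1)`: the junction's spelling, the real-valued form `π · C = V₂`, and the VALUE `C = π² ∕ 2`
# ((U) road, U4-DISCHARGE (W2)-(n2), FILE 6; Helgason 2000 Introduction §4; Rogawski 1990 §8.2 p. 118)

Topic `NumberTheory/Weil1964`, namespace `Literature.NumberTheory.Weil1964.UnitaryArchLocalTopForm`.  THEOREMS ONLY (no definition, no instance, no notation, no named fact,
no `sorry`).  Cell `pub/hodgecm-mathlib`, crux H413 = `stmt-HodgeConjecture-24833` (supports only).  Over ★ FILE 5 `topFormDiscConstant_mul_pi_eq_setLIntegral`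
(`C · π = ∫⁻_{source(1₂)} w₀ dλ` for every `C` with `(μ^TF_{diag(1,−1)}).map π = C • μ_hyp`):
* `topFormDiscConstant_mul_pi_eq_setLIntegral_diagonal_one` — the same with `V₂`'s carrier spelled `J₁ = diagonal (fun _ => ((1 : ℝ) : ℂ))` (★ A-p19 (g24)
  `blockMass_two_of_massEqSource`, ★ p844932 `archTopFormWallCompatible_of_massEqSource_of_rankOneConstant`'s `hR1G` constant `−V₂`);
* `toNNReal_setLIntegral_diagonal_one_eq_pi_mul_topFormDiscConstant` — `((V₂-integral).toNNReal : ℝ) = π · C` (the real number the (R1G)-explicit clause carries);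
* `topFormDiscConstant_eq` — THE VALUE `C = π² ∕ 2` (★ A-p12 (g20) `lintegral_cayleyWeightC_two : ∫⁻_{𝔲(2)} w₀ dλ = π³ ∕ 2`), and `exists_topFormDiscConstant_eq_pi_sq_half`.
HONEST LABEL: HC_CM is proved only modulo the 2 remaining named inputs (hLiu418 24832, h413 24833) until rung 0 closes; U4 is an in-house normalisation statement and this
file is one brick of its discharge — nothing printed is discharged here.

## References
* S. Helgason, *Groups and Geometric Analysis*, AMS Math. Surveys Monogr. 83 (2000), Introduction §4; Ch. I §1 Thm. 1.14 p. 96. [Helgason2000]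
* J. D. Rogawski, *Automorphic Representations of Unitary Groups in Three Variables*, Ann. of Math. Stud. 123 (1990), §1.7 p. 6, §8.2 p. 118. [Rogawski1990]
-/

set_option autoImplicit false
-- submodule-normed vs subtype topologies on `↥(skewC …)` (as in ★ U1 FILE B ∕ FILES 1–5)
set_option backward.isDefEq.respectTransparency false

noncomputable section

open Set Filter Topology MeasureTheory MeasureTheory.Measure NumberField NumberField.InfinitePlace Literature.Analysis.Calculus Literature.Analysis.Complex
open scoped Classical Matrix Matrix.Norms.Operator MatrixGroups ENNReal NNReal ComplexConjugate

namespace Literature.NumberTheory.Weil1964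

namespace UnitaryArchLocalTopForm

open Literature.NumberTheory.Automorphic Literature.NumberTheory.Automorphic.UnitaryGroup

section Value

variable (L : Type) [Field L] [NumberField L] [IsCMField L] [MeasurableSpace (GL (Fin 2) ℂ)] [BorelSpace (GL (Fin 2) ℂ)]

/-- **`C · π = V₂` IN THE JUNCTION'S SPELLING** (`V₂`'s carrier `J₁ = diagonal (fun _ => ((1 : ℝ) : ℂ)) = 1₂`, ★ `blockMass_two_of_massEqSource`, ★ p844932's `hR1G` constant):
`(C : ℝ≥0∞) · π = ∫⁻_{source(J₁)} w₀ dλ`. [cite: Helgason2000, Introduction §4; Ch. I §1 Thm. 1.14 p. 96] [cite: Rogawski1990, §8.2 p. 118] -/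
theorem topFormDiscConstant_mul_pi_eq_setLIntegral_diagonal_one (w : {w : InfinitePlace L // IsComplex w}) {C : ℝ≥0}
    (hC : (localTopFormHaar 2 (Matrix.diagonal ![(1 : ℂ), -1])).map
        (fun h : unitaryGroupOfForm (starRingEnd ℂ) (Matrix.diagonal ![(1 : ℂ), -1]) => discMoebius ((h : GL (Fin 2) ℂ) : Matrix (Fin 2) (Fin 2) ℂ) 0) = C • discHyperbolicMeasure)
    [MeasurableSpace (skewC 2 (Matrix.diagonal fun _ : Fin 2 => ((1 : ℝ) : ℂ)))] [BorelSpace (skewC 2 (Matrix.diagonal fun _ : Fin 2 => ((1 : ℝ) : ℂ)))] :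
    (C : ℝ≥0∞) * NNReal.pi =
      ∫⁻ Y in cayleySourceC 2 (Matrix.diagonal fun _ : Fin 2 => ((1 : ℝ) : ℂ)), ENNReal.ofReal (cayleyWeightC 2 (Matrix.diagonal fun _ : Fin 2 => ((1 : ℝ) : ℂ)) Y)
        ∂lieStdLebesgueC 2 (Matrix.diagonal fun _ : Fin 2 => ((1 : ℝ) : ℂ)) := by
  letI : MeasurableSpace (skewC 2 (Matrix.diagonal ![(1 : ℂ), -1])) := borel _
  haveI : BorelSpace (skewC 2 (Matrix.diagonal ![(1 : ℂ), -1])) := ⟨rfl⟩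
  -- generalise the carrier `1₂`, then substitute its `diagonal (fun _ => 1)` spelling
  have key : ∀ J : Matrix (Fin 2) (Fin 2) ℂ, J = 1 → ∀ [MeasurableSpace (skewC 2 J)] [BorelSpace (skewC 2 J)],
      (C : ℝ≥0∞) * NNReal.pi = ∫⁻ Y in cayleySourceC 2 J, ENNReal.ofReal (cayleyWeightC 2 J Y) ∂lieStdLebesgueC 2 J := by
    rintro J rfl _ _
    exact topFormDiscConstant_mul_pi_eq_setLIntegral L w hC
  exact key _ (by rw [Complex.ofReal_one, Matrix.diagonal_one])

/-- **THE REAL-VALUED FORM `π · C = V₂`**, `V₂ := (∫⁻_{source(J₁)} w₀ dλ).toNNReal` (the constant of ★ p844932's `hR1G` is `−V₂`): `((V₂-integral).toNNReal : ℝ) = π · C`.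
[cite: Helgason2000, Introduction §4] [cite: Rogawski1990, §8.2 p. 118] -/
theorem toNNReal_setLIntegral_diagonal_one_eq_pi_mul_topFormDiscConstant (w : {w : InfinitePlace L // IsComplex w}) {C : ℝ≥0}
    (hC : (localTopFormHaar 2 (Matrix.diagonal ![(1 : ℂ), -1])).map
        (fun h : unitaryGroupOfForm (starRingEnd ℂ) (Matrix.diagonal ![(1 : ℂ), -1]) => discMoebius ((h : GL (Fin 2) ℂ) : Matrix (Fin 2) (Fin 2) ℂ) 0) = C • discHyperbolicMeasure)
    [MeasurableSpace (skewC 2 (Matrix.diagonal fun _ : Fin 2 => ((1 : ℝ) : ℂ)))] [BorelSpace (skewC 2 (Matrix.diagonal fun _ : Fin 2 => ((1 : ℝ) : ℂ)))] :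
    (((∫⁻ Y in cayleySourceC 2 (Matrix.diagonal fun _ : Fin 2 => ((1 : ℝ) : ℂ)), ENNReal.ofReal (cayleyWeightC 2 (Matrix.diagonal fun _ : Fin 2 => ((1 : ℝ) : ℂ)) Y)
        ∂lieStdLebesgueC 2 (Matrix.diagonal fun _ : Fin 2 => ((1 : ℝ) : ℂ))).toNNReal : ℝ≥0) : ℝ) = Real.pi * C := by
  rw [← topFormDiscConstant_mul_pi_eq_setLIntegral_diagonal_one L w hC, ENNReal.toNNReal_mul, ENNReal.toNNReal_coe, ENNReal.toNNReal_coe, NNReal.coe_mul,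
    NNReal.coe_real_pi, mul_comm]

/-- **THE VALUE `C_disc^TF = π² ∕ 2`** (owner's MEMO-U4-NC-v1 §0 (c)): from `C · π = ∫_{𝔲(2)} w₀ dλ` and ★ A-p12 (g20) `lintegral_cayleyWeightC_two` (`= π³ ∕ 2`).
[cite: Helgason2000, Introduction §4] [cite: Rogawski1990, §8.2 p. 118] -/
theorem topFormDiscConstant_eq (w : {w : InfinitePlace L // IsComplex w}) {C : ℝ≥0}
    (hC : (localTopFormHaar 2 (Matrix.diagonal ![(1 : ℂ), -1])).map
        (fun h : unitaryGroupOfForm (starRingEnd ℂ) (Matrix.diagonal ![(1 : ℂ), -1]) => discMoebius ((h : GL (Fin 2) ℂ) : Matrix (Fin 2) (Fin 2) ℂ) 0) = C • discHyperbolicMeasure) :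
    (C : ℝ) = Real.pi ^ 2 / 2 := by
  letI : MeasurableSpace (skewC 2 (Matrix.diagonal ![(1 : ℂ), -1])) := borel _
  haveI : BorelSpace (skewC 2 (Matrix.diagonal ![(1 : ℂ), -1])) := ⟨rfl⟩
  letI : MeasurableSpace (skewC 2 (1 : Matrix (Fin 2) (Fin 2) ℂ)) := borel _
  haveI : BorelSpace (skewC 2 (1 : Matrix (Fin 2) (Fin 2) ℂ)) := ⟨rfl⟩
  have h := topFormDiscConstant_mul_pi_eq_lintegral L w hC
  rw [lintegral_cayleyWeightC_two rfl] at h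
  have h' := congrArg ENNReal.toReal h
  rw [ENNReal.toReal_mul, ENNReal.coe_toReal, ENNReal.coe_toReal, NNReal.coe_real_pi, ENNReal.toReal_ofReal (by positivity)] at h'
  have hπ : Real.pi ≠ 0 := Real.pi_ne_zero
  field_simp at h'
  nlinarith [h']

/-- **EXISTENCE WITH THE VALUE**: `(μ^TF_{J₋}).map π = (π²∕2) • μ_hyp` for some (hence the) `C = π² ∕ 2 : ℝ≥0` — the owner's paper number, now ★.
[cite: Helgason2000, Introduction §4] [cite: Rogawski1990, §8.2 p. 118] -/
theorem exists_topFormDiscConstant_eq_pi_sq_half (w : {w : InfinitePlace L // IsComplex w}) :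
    ∃ C : ℝ≥0, (C : ℝ) = Real.pi ^ 2 / 2 ∧
      (localTopFormHaar 2 (Matrix.diagonal ![(1 : ℂ), -1])).map
          (fun h : unitaryGroupOfForm (starRingEnd ℂ) (Matrix.diagonal ![(1 : ℂ), -1]) => discMoebius ((h : GL (Fin 2) ℂ) : Matrix (Fin 2) (Fin 2) ℂ) 0) = C • discHyperbolicMeasure := by
  letI : MeasurableSpace (skewC 2 (Matrix.diagonal ![(1 : ℂ), -1])) := borel _
  haveI : BorelSpace (skewC 2 (Matrix.diagonal ![(1 : ℂ), -1])) := ⟨rfl⟩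
  letI : MeasurableSpace (skewC 2 (1 : Matrix (Fin 2) (Fin 2) ℂ)) := borel _
  haveI : BorelSpace (skewC 2 (1 : Matrix (Fin 2) (Fin 2) ℂ)) := ⟨rfl⟩
  obtain ⟨C, -, hC, -⟩ := exists_topFormDiscConstant L w
  exact ⟨C, topFormDiscConstant_eq L w hC, hC⟩

end Value

end UnitaryArchLocalTopForm

end Literature.NumberTheory.Weil1964

end
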